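import Summits.HodgeConjecture.HodgeConjecture.Theorems.MarkmanPartnerTransportLowPicardRMCellsKappa

/-!
# Route MarkmanPartnerTransport · crux #5 `LowPicardRealMultiplication` (stmt-HodgeConjecture-19653) —
# «ORPHAN ONE-CLASS, X-SIDE»: HC⁴ on a cell is the algebraicity of the `d − 1` kappa classes `κ_θ, …, κ_{θ^{d−1}}`
# (Charles–Markman-free), and the orphan cell `(1,2)` is EXACTLY the one class `κ_θ`

Cell hodge-nonav, chapter ROUTE-P1AL; planner p1 g40 ASSIGN (G) «ORPHAN ONE-CLASS, X-SIDE» (2026-08-28T18:19Z); prover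
seat hodge-nonav-20241-p1 (gen 16). Route-independent (no Theses import; the notations of `…LowPicardRMCellsKappa` are
copied verbatim); `--supports stmt-HodgeConjecture-19653` helper.

The `X`-side graph-class infrastructure is in the tree (KAPPA-ANY, `…HodgeClassesModKappaClassesAnyDegree`: on a marked
smooth projective `K3^{[2]}`-type `X` whose transcendental Hodge endomorphisms are rational polynomials in one rational,
type-preserving, `q`-self-adjoint `θ`, HC⁴(X) ⟺ `κ_{θᵏ} ∈ A²(X)` for ALL `k`, mod {Verbitsky–Guan, O'Grady 2008};
and ⟺ `κ_θ` alone mod Charles–Markman 2013 in addition). This file sharpens it to the planner's statement «the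
`d − 1` graph classes» WITHOUT Charles–Markman:

* `exists_kappaLinear` — `g ↦ κ_g = Kap[φ, g]` is `ℂ`-linear in `g`; `kappaClass_one_eq_dualBBFClass`,
  `kappaClass_one_mem_algebraicClasses` — `κ_1 = q^∨` is O'Grady's dual class, algebraic;
* **`kappaClass_mem_algebraicClasses_of_eq_zero_on_transcendental`** («KAPPA-NS») — for `g` rational,
  `(1,1)`-preserving, `q`-self-adjoint and ZERO on `T_q(X)`, `κ_g ∈ A²(X)`: its cubic `(κ_g ∪ y) ∪ w =
  (t·q(y,w) + 2q(gy,w))·P` (`exists_cup3_kappaClass`) is the transcendental scalar `t`, so the tree's `E = ℚ` engine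
  (`k3HilbertForm_blockForm_of_transcendentalScalar`, `exists_algebraicClass_of_symmetricForm`, `eq_of_cup3_eq`) makes it
  algebraic; mod {Verbitsky–Guan, O'Grady 2008};
* **`hodgeConjectureFor_iff_kappaClass_pow_lt_mem_algebraicClasses`** («KAPPA-IFF-SHARP») — with the GEN clause of
  `RMgen[X, φ, z, d]` (`E(X) = ℚ[θ|_T]`, `[E:ℚ] = d`), **HC⁴(X) ⟺ `κ_{θᵏ} ∈ A²(X)` for `1 ≤ k ≤ d − 1`**: for `k ≥ d`
  (and `k = 0`) GEN writes `θᵏ = Σ_{i<d} cᵢ θⁱ` on `T(X)`, the difference is a `g` as in KAPPA-NS, and `κ` is linear;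
  mod {Verbitsky–Guan, O'Grady 2008} — NO Charles–Markman, no partner, no Markman, no Beauville;
  `hodgeConjectureFor_of_kappaClass_pow_lt_mem_algebraicClasses` is the pointwise (⇐);
* `cellHC_iff_cellKappa_of_two` — on the QUADRATIC cells (`d = 2`) `CellHC[ρ, 2] ↔ CellKappa[ρ, 2]` mod
  {Verbitsky–Guan, O'Grady 2008} only (the tree's `cellHC_iff_cellKappa` needs Charles–Markman); in particular
  **`orphanCellHC_12 : CellKappa[1, 2] → CellHC[1, 2]`** and `cellHC_12_iff_cellKappa_12`.

HONEST RESIDUAL. The cell `(1,2)` (`ρ(X) = 1`, `E(X)` real quadratic) has NO projective K3 partner (a partner has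
`ρ(S) = ρ(X) − 1 = 0`, impossible for a projective K3 surface), so the partner route of `…LowPicardRMPartneredCells`
(ONE cycle on `S`) is void there; by Verbitsky–Guan `H⁴ = Sym² H²`, `(N¹ ⊗ T)^{Hdg} = 0` and Zarhin, its Hodge
conjecture is EXACTLY the algebraicity of the ONE rational `(2,2)`-class `κ_θ` (equivalently the graph class `t_θ` of
the generator of `E`) — and NOTHING in print or in the tree constructs it (Kuga–Satake, `cellHC_two_of_kugaSatake`, is
the only known road, itself conditional). For `d ≥ 3` the `X` side needs the `d − 1` classes `κ_θ, …, κ_{θ^{d−1}}`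
(there is no ring structure on `H⁴(X)` to generate them from `κ_θ` without Charles–Markman's Lefschetz operator), which
is WHY the partner route (one cycle on the K3 surface, whose correspondences DO compose) is used on every other cell.
CONDITIONAL on the displayed named facts; no definition, no sorry, no new named fact; credits nothing to HC.

References: K. O'Grady, Commun. Contemp. Math. 10 (2008) §2.2, §3; S. Novario, Kyoto J. Math. 66 (2026) Thm. 6.2, §4;
M. Verbitsky, GAFA 6 (1996); Yu. G. Zarhin, J. reine angew. Math. 341 (1983) Thm. 1.5.1; E. Markman, JEMS (2024) §1.1;
F. Charles, E. Markman, Compos. Math. 149 (2013) Thm. 1.1 (NOT used here).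
-/

noncomputable section

set_option linter.dupNamespace false

open scoped Matrix
open Module CategoryTheory
open Literature.AlgebraicTopology.SingularHomology Literature.Geometry.Kaehler
open Literature.AlgebraicGeometry Literature.AlgebraicGeometry.Motives Literature.AlgebraicGeometry.HodgeTheory
open Literature.AlgebraicGeometry.Hyperkaehler Literature.AlgebraicGeometry.Surfaces
open Summit.HodgeConjecture.HodgeConjecture.Theorems.NikulinTwinTransport
open Summit.HodgeConjecture.HodgeConjecture.Theorems.MarkmanPartnerTransport.BBFPositivity

namespace Summit.HodgeConjecture.HodgeConjecture.Theorems.MarkmanPartnerTransport.PartnerLattice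

/-- `MarkedK3Sq[X, φ, P, z]`: VERBATIM the `let MarkedK3Sq := …` binder of the route declarations of
MarkmanPartnerTransport (clauses (m1)–(m6)). Local notation only. -/
local notation3 (prettyPrint := false) "MarkedK3Sq[" X ", " φ ", " P ", " z "]" =>
  (((IsIntegralClass P ∧ ∀ Q : complexBetti X (2 * 4), IsIntegralClass Q → ∃ n : ℤ, Q = n • P) ∧
    (∀ c : complexBetti X 2, IsIntegralClass c ↔ ∃ v : K3HilbertIndex → ℤ, φ c = fun i => (v i : ℂ)) ∧
    (∀ a : complexBetti X 2, cupPowTwo a 4 = ((3 : ℂ) * (k3HilbertForm 2 (φ a) (φ a)) ^ 2) • P) ∧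
    (IsOfHodgeType 4 X 2 2 0 (LinearEquiv.symm φ z) ∧
      ∀ τ : complexBetti X 2, IsOfHodgeType 4 X 2 2 0 τ → ∃ t : ℂ, τ = t • LinearEquiv.symm φ z) ∧
    (∀ c : complexBetti X 2, IsOfHodgeType 4 X 2 1 1 c ↔
      (k3HilbertForm 2 (φ c) z = 0 ∧ k3HilbertForm 2 (φ c) (star z) = 0)) ∧
    (k3HilbertForm 2 z z = 0 ∧ 0 < (k3HilbertForm 2 (star z) z).re)))

/-- `SpIso[X, φ]`: VERBATIM the `let SpannedByIsometries := …` binder of the route declarations (with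
`IsBBFTransc` unfolded). Local notation only. -/
local notation3 (prettyPrint := false) "SpIso[" X ", " φ "]" =>
  (∀ f : complexBetti X 2 →ₗ[ℂ] complexBetti X 2, (∀ y, IsRationalClass y → IsRationalClass (f y)) →
    (∀ (i j : ℕ) y, IsOfHodgeType 4 X 2 i j y → IsOfHodgeType 4 X 2 i j (f y)) →
    (∀ d : complexBetti X 2, d ∈ algebraicClasses X 1 → f d = 0) →
    (∀ y : complexBetti X 2, ∀ d : complexBetti X 2, d ∈ algebraicClasses X 1 →
      k3HilbertForm 2 (φ (f y)) (φ d) = 0) →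
    ∃ (k : ℕ) (c : Fin k → ℚ) (g : Fin k → (complexBetti X 2 →ₗ[ℂ] complexBetti X 2)),
      (∀ i, Function.Bijective (g i) ∧ (∀ y, IsRationalClass y → IsRationalClass (g i y)) ∧
        (∀ (a b : ℕ) y, IsOfHodgeType 4 X 2 a b y → IsOfHodgeType 4 X 2 a b (g i y)) ∧
        (∀ a b, k3HilbertForm 2 (φ (g i a)) (φ (g i b)) = k3HilbertForm 2 (φ a) (φ b))) ∧
      ∀ y : complexBetti X 2, (∀ d : complexBetti X 2, d ∈ algebraicClasses X 1 →
        k3HilbertForm 2 (φ y) (φ d) = 0) → f y = ∑ i : Fin k, ((c i : ℂ) • g i y))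

/-- `RMgen[X, φ, z, d]` («RMgen» data, the `RMGenData` of Sketch P1AK-CELLS with self-adjointness added): a
rational, type-preserving, `q`-self-adjoint endomorphism `θ` of `H²(X(ℂ); ℂ)` with `θ σ = ev · σ`, `ev` real,
`deg minpoly_ℚ(ev) = d`, `d · n + ρ(X) = 23` for some `n ≥ 3`, and GEN: every rational type-preserving endomorphism
is `Σ_{i<d} cᵢ θⁱ` (`cᵢ ∈ ℚ`) on `T(X)_ℂ = {y : q(φ y, φ N¹(X)) = 0}`. Local notation only. -/
local notation3 (prettyPrint := false) "RMgen[" X ", " φ ", " z ", " d "]" =>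
  (∃ θ : complexBetti X 2 →ₗ[ℂ] complexBetti X 2, (∀ y, IsRationalClass y → IsRationalClass (θ y)) ∧
    (∀ (i j : ℕ) y, IsOfHodgeType 4 X 2 i j y → IsOfHodgeType 4 X 2 i j (θ y)) ∧
    (∀ y w : complexBetti X 2, k3HilbertForm 2 (φ (θ y)) (φ w) = k3HilbertForm 2 (φ y) (φ (θ w))) ∧
    ∃ ev : ℂ, θ (LinearEquiv.symm φ z) = ev • LinearEquiv.symm φ z ∧ ev.im = 0 ∧
      (minpoly ℚ ev).natDegree = d ∧
      (∃ n : ℕ, 3 ≤ n ∧ d * n + Module.finrank ℂ ↥(algebraicClasses X 1) = 23) ∧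
      ∀ f : complexBetti X 2 →ₗ[ℂ] complexBetti X 2, (∀ y, IsRationalClass y → IsRationalClass (f y)) →
        (∀ (i j : ℕ) y, IsOfHodgeType 4 X 2 i j y → IsOfHodgeType 4 X 2 i j (f y)) →
        ∃ c : Fin d → ℚ, ∀ y : complexBetti X 2,
          (∀ a : complexBetti X 2, a ∈ algebraicClasses X 1 → k3HilbertForm 2 (φ y) (φ a) = 0) →
            f y = ∑ i : Fin d, ((c i : ℂ) • (θ ^ (i : ℕ)) y))

/-- `Kap[φ, g] = Σ_{ij} (G⁻¹)_{ij} · φ⁻¹eᵢ ∪ g(φ⁻¹eⱼ) ∈ H⁴(X(ℂ); ℂ)`, the kappa class of an endomorphism `g`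
of `H²(X(ℂ); ℂ)` (VERBATIM `…K3Sq2TypeHodgeGraphClassesGeneral`). Local notation only. -/
local notation3 (prettyPrint := false) "Kap[" φ ", " g "]" =>
  (∑ i : K3HilbertIndex, ∑ j : K3HilbertIndex,
    (((k3HilbertGram 2).map (Int.cast : ℤ → ℂ))⁻¹ i j) •
      cupProduct (rfl : 2 + 2 = 2 * 2) ((LinearEquiv.symm φ) (Pi.single i 1))
        (g ((LinearEquiv.symm φ) (Pi.single j 1))))

/-- `CellHC[ρ, d]`: **HC⁴ on the cell `(ρ(X), [E:ℚ]) = (ρ, d)`** — for every marked smooth projective `K3^{[2]}`-type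
`(X, φ, P, z)` with `¬ SpannedByIsometries`, `ρ(X) = ρ` and `RMgen[X, φ, z, d]` (the `InCell`/`CellHC` of Sketch
P1AK-CELLS, curried), `HodgeConjectureFor 4 X`. Local notation only. -/
local notation3 (prettyPrint := false) "CellHC[" ρ ", " d "]" =>
  (∀ (X : SchemeOver ℂ), IsSmoothProjective 4 X → IsOfK3HilbertSquareType X →
    ∀ (φ : complexBetti X 2 ≃ₗ[ℂ] (K3HilbertIndex → ℂ)) (P : complexBetti X (2 * 4)) (z : K3HilbertIndex → ℂ),
      MarkedK3Sq[X, φ, P, z] → ¬ SpIso[X, φ] → Module.finrank ℂ ↥(algebraicClasses X 1) = ρ →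
        RMgen[X, φ, z, d] → HodgeConjectureFor 4 X)

/-- `CellKappa[ρ, d]`: **`κ_θ ∈ A²(X)` on the cell `(ρ, d)`** — for every marked smooth projective `K3^{[2]}`-type
`(X, φ, P, z)` with `¬ SpannedByIsometries`, `ρ(X) = ρ`, and every `θ` carrying the data of `RMgen[X, φ, z, d]`, the
kappa class `κ_θ` is algebraic. Local notation only. -/
local notation3 (prettyPrint := false) "CellKappa[" ρ ", " d "]" =>
  (∀ (X : SchemeOver ℂ), IsSmoothProjective 4 X → IsOfK3HilbertSquareType X →
    ∀ (φ : complexBetti X 2 ≃ₗ[ℂ] (K3HilbertIndex → ℂ)) (P : complexBetti X (2 * 4)) (z : K3HilbertIndex → ℂ),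
      MarkedK3Sq[X, φ, P, z] → ¬ SpIso[X, φ] → Module.finrank ℂ ↥(algebraicClasses X 1) = ρ →
        ∀ θ : complexBetti X 2 →ₗ[ℂ] complexBetti X 2, (∀ y, IsRationalClass y → IsRationalClass (θ y)) →
          (∀ (i j : ℕ) y, IsOfHodgeType 4 X 2 i j y → IsOfHodgeType 4 X 2 i j (θ y)) →
          (∀ y w : complexBetti X 2, k3HilbertForm 2 (φ (θ y)) (φ w) = k3HilbertForm 2 (φ y) (φ (θ w))) →
          (∃ ev : ℂ, θ (LinearEquiv.symm φ z) = ev • LinearEquiv.symm φ z ∧ ev.im = 0 ∧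
            (minpoly ℚ ev).natDegree = d ∧
            (∃ n : ℕ, 3 ≤ n ∧ d * n + Module.finrank ℂ ↥(algebraicClasses X 1) = 23) ∧
            ∀ f : complexBetti X 2 →ₗ[ℂ] complexBetti X 2, (∀ y, IsRationalClass y → IsRationalClass (f y)) →
              (∀ (i j : ℕ) y, IsOfHodgeType 4 X 2 i j y → IsOfHodgeType 4 X 2 i j (f y)) →
              ∃ c : Fin d → ℚ, ∀ y : complexBetti X 2,
                (∀ a : complexBetti X 2, a ∈ algebraicClasses X 1 → k3HilbertForm 2 (φ y) (φ a) = 0) →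
                  f y = ∑ i : Fin d, ((c i : ℂ) • (θ ^ (i : ℕ)) y)) →
          Kap[φ, θ] ∈ algebraicClasses X 2)

/-- `Cup3[c, y, w] = (c ∪ y) ∪ w ∈ H⁸` for `c ∈ H⁴`, `y, w ∈ H²`. Local notation only. -/
local notation3 (prettyPrint := false) "Cup3[" c ", " y ", " w "]" =>
  cupProduct (rfl : 2 * 3 + 2 = 2 * 4) (cupProduct (rfl : 2 * 2 + 2 = 2 * 3) c y) w

variable {X : SchemeOver ℂ} {φ : complexBetti X 2 ≃ₗ[ℂ] (K3HilbertIndex → ℂ)} {P : complexBetti X (2 * 4)}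
  {z : K3HilbertIndex → ℂ}

/-! ### §1 `κ` is linear in `g`; `κ_1 = q^∨` -/

/-- **`g ↦ κ_g` is `ℂ`-linear** (`κ_g = Σᵢⱼ (G⁻¹)ᵢⱼ φ⁻¹eᵢ ∪ g(φ⁻¹eⱼ)` and the cup product is bilinear).
[cite: OGrady2008NumericalK3Square, §2.2] -/
theorem exists_kappaLinear (φ : complexBetti X 2 ≃ₗ[ℂ] (K3HilbertIndex → ℂ)) :
    ∃ L : (complexBetti X 2 →ₗ[ℂ] complexBetti X 2) →ₗ[ℂ] complexBetti X (2 * 2),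
      ∀ g : complexBetti X 2 →ₗ[ℂ] complexBetti X 2, L g = Kap[φ, g] := by
  refine ⟨{ toFun := fun g => Kap[φ, g]
            map_add' := fun g h => ?_
            map_smul' := fun c g => ?_ }, fun g => rfl⟩
  · simp only [LinearMap.add_apply, map_add, smul_add, Finset.sum_add_distrib]
  · simp only [LinearMap.smul_apply, map_smul, RingHom.id_apply, Finset.smul_sum]
    refine Finset.sum_congr rfl fun i _ => Finset.sum_congr rfl fun j _ => ?_
    rw [smul_comm]

/-- **`κ_1 = q^∨`**: the kappa class of the identity is O'Grady's dual Beauville–Bogomolov class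
(`(G ⊗ ℂ)⁻¹ = G⁻¹ ⊗ ℂ`, `k3HilbertGram_map_inv_apply`). [cite: OGrady2008NumericalK3Square, §3 (definition of q^∨)] -/
theorem kappaClass_one_eq_dualBBFClass (φ : complexBetti X 2 ≃ₗ[ℂ] (K3HilbertIndex → ℂ)) :
    Kap[φ, (1 : complexBetti X 2 →ₗ[ℂ] complexBetti X 2)] = dualBBFClass 2 φ := by
  rw [dualBBFClass_def]
  refine Finset.sum_congr rfl fun i _ => Finset.sum_congr rfl fun j _ => ?_
  rw [k3HilbertGram_map_inv_apply, Module.End.one_apply]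

/-- **`κ_1 ∈ A²(X)`** on a marked smooth projective `K3^{[2]}`-type fourfold (O'Grady: `q^∨` is algebraic).
[cite: OGrady2008NumericalK3Square, §3 Claim 3.1] -/
theorem kappaClass_one_mem_algebraicClasses (hO : OGrady2008_dualBBFClass_algebraic) (hX : IsSmoothProjective 4 X)
    (hK : IsOfK3HilbertSquareType X) (hM : MarkedK3Sq[X, φ, P, z]) :
    Kap[φ, (1 : complexBetti X 2 →ₗ[ℂ] complexBetti X 2)] ∈ algebraicClasses X 2 := by
  rw [kappaClass_one_eq_dualBBFClass]
  exact (hO X hX hK φ P (isMarkedK3Hilb_of_marked hM)).1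

/-! ### §2 «KAPPA-NS»: the kappa class of an endomorphism vanishing on `T(X)` is algebraic -/

/-- **«KAPPA-NS».** On a marked smooth projective `K3^{[2]}`-type `(X, φ, P, z)`, for an endomorphism `g` of
`H²(X(ℂ); ℂ)` which is rational, `(1,1)`-preserving, `q`-self-adjoint and ZERO on the `q`-transcendental classes,
`κ_g ∈ A²(X)`. Proof: `(κ_g ∪ y) ∪ w = (t·q(y,w) + 2·q(gy,w))·P` (`exists_cup3_kappaClass`, self-adjointness), i.e.
`κ_g` has the `q`-self-adjoint «class endomorphism» `G = t + 2g`, whose transcendental compression is the SCALAR `t`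
(`g|_T = 0`) and which kills `N¹(X)` after `π_T` (`g(N¹) ⊆ N¹`); the block form + the symmetric-form engine produce an
ALGEBRAIC `c'` with the same cubic, and `κ_g = c'` since cubics separate `H⁴` (Verbitsky–Guan). Modulo
{Verbitsky–Guan, O'Grady 2008}. [cite: Novario2026HodgeClassesHilbertSquares, Thm. 6.2 and §4]
[cite: OGrady2008NumericalK3Square, §2.2 and §3] [cite: Zarhin1983HodgeGroupsK3, Thm. 1.5.1] -/
theorem kappaClass_mem_algebraicClasses_of_eq_zero_on_transcendental
    (hV : VerbitskyGuan_cohomology_K3HilbertSquareType) (hO : OGrady2008_dualBBFClass_algebraic)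
    (hX : IsSmoothProjective 4 X) (hK : IsOfK3HilbertSquareType X) (hM : MarkedK3Sq[X, φ, P, z])
    (g : complexBetti X 2 →ₗ[ℂ] complexBetti X 2)
    (h1 : ∀ y, IsRationalClass y → IsRationalClass (g y))
    (h11 : ∀ y, IsOfHodgeType 4 X 2 1 1 y → IsOfHodgeType 4 X 2 1 1 (g y))
    (h5 : ∀ y w : complexBetti X 2, k3HilbertForm 2 (φ (g y)) (φ w) = k3HilbertForm 2 (φ y) (φ (g w)))
    (hT : ∀ y : complexBetti X 2, (∀ d ∈ algebraicClasses X 1, k3HilbertForm 2 (φ y) (φ d) = 0) → g y = 0) :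
    Kap[φ, g] ∈ algebraicClasses X 2 := by
  classical
  obtain ⟨t, ht⟩ := exists_cup3_kappaClass hM g
  obtain ⟨πT, hT1, hT2, hT3, hT4, -, hT6, -⟩ := exists_transcendentalProjector hX hM
  have hgN : ∀ d ∈ algebraicClasses X 1, g d ∈ algebraicClasses X 1 :=
    map_mem_algebraicClasses_one_of_rational_hodge hX g h1 h11
  -- the class endomorphism `G = t + 2g` of `κ_g`
  set G : complexBetti X 2 →ₗ[ℂ] complexBetti X 2 := t • LinearMap.id + (2 : ℂ) • g with hGdef
  have hGapp : ∀ y, G y = t • y + (2 : ℂ) • g y := fun y => by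
    simp only [hGdef, LinearMap.add_apply, LinearMap.smul_apply, LinearMap.id_apply]
  have hqG : ∀ y w, k3HilbertForm 2 (φ (G y)) (φ w) =
      t * k3HilbertForm 2 (φ y) (φ w) + 2 * k3HilbertForm 2 (φ (g y)) (φ w) := fun y w => by
    rw [hGapp, map_add, map_smul, map_smul, k3HilbertForm_add_left, k3HilbertForm_smul_left, k3HilbertForm_smul_left]
  have hGadj : ∀ y w, k3HilbertForm 2 (φ (G y)) (φ w) = k3HilbertForm 2 (φ y) (φ (G w)) := fun y w => by
    rw [hqG, k3HilbertForm_comm 2 (φ y) (φ (G w)), hqG, h5, k3HilbertForm_comm 2 (φ w) (φ y),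
      k3HilbertForm_comm 2 (φ (g w)) (φ y)]
  have hA : ∀ d ∈ algebraicClasses X 1, πT (G d) = 0 := fun d hd => by
    rw [hGapp, map_add, map_smul, map_smul, hT1 d hd, hT1 _ (hgN d hd), smul_zero, smul_zero, add_zero]
  have hC : ∀ y : complexBetti X 2, (∀ d ∈ algebraicClasses X 1, k3HilbertForm 2 (φ y) (φ d) = 0) →
      πT (G y) = t • y := fun y hy => by
    rw [hGapp, map_add, map_smul, map_smul, hT2 y hy, hT y hy, map_zero, smul_zero, add_zero]
  have hβG := k3HilbertForm_blockForm_of_transcendentalScalar φ hGadj hT2 hT3 hT4 hT6 hA hC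
  -- the symmetric form on `N¹(X)`
  set qXform : LinearMap.BilinForm ℂ (complexBetti X 2) :=
    (Matrix.toBilin' (Matrix.map (k3HilbertGram 2) (Int.cast : ℤ → ℂ))).compl₁₂
      (φ : complexBetti X 2 →ₗ[ℂ] (K3HilbertIndex → ℂ)) (φ : complexBetti X 2 →ₗ[ℂ] (K3HilbertIndex → ℂ))
    with hqXform
  have hqXapp : ∀ y w, qXform y w = k3HilbertForm 2 (φ y) (φ w) := fun y w => by
    rw [hqXform, LinearMap.compl₁₂_apply, qC_apply]; rfl
  set β : complexBetti X 2 →ₗ[ℂ] complexBetti X 2 →ₗ[ℂ] ℂ :=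
    qXform.compl₁₂ G LinearMap.id - t • qXform with hβraw
  have hβdef : ∀ y w, β y w = k3HilbertForm 2 (φ (G y)) (φ w) - t * k3HilbertForm 2 (φ y) (φ w) := by
    intro y w
    rw [hβraw, LinearMap.sub_apply, LinearMap.smul_apply, LinearMap.sub_apply, LinearMap.smul_apply,
      LinearMap.compl₁₂_apply, LinearMap.id_apply, hqXapp, hqXapp, smul_eq_mul]
  clear_value β
  have hβsymm : ∀ y w, β y w = β w y := fun y w => by
    rw [hβdef, hβdef, hGadj, k3HilbertForm_comm 2 (φ y) (φ (G w)), k3HilbertForm_comm 2 (φ y) (φ w)]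
  have hNT : ∀ n ∈ algebraicClasses X 1, ∀ w, k3HilbertForm 2 (φ n) (φ (πT w)) = 0 := fun n hn w => by
    rw [k3HilbertForm_comm]; exact hT3 w n hn
  have hqr : ∀ n ∈ algebraicClasses X 1, ∀ y : complexBetti X 2,
      k3HilbertForm 2 (φ n) (φ (y - πT y)) = k3HilbertForm 2 (φ n) (φ y) := by
    intro n hn y
    rw [map_sub, sub_eq_add_neg, k3HilbertForm_add_right, ← neg_one_smul ℂ, k3HilbertForm_smul_right,
      hNT n hn y, mul_zero, add_zero]
  obtain ⟨c', hc'alg, hc'⟩ := exists_algebraicClass_of_symmetricForm hO Voisin2003_cupProduct_algebraicClasses_holds'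
    hX hK hM t β hβsymm (fun y => y - πT y) hT4 hqr
  -- same cubic, hence the same class
  have hcup3 : ∀ y w : complexBetti X 2, Cup3[Kap[φ, g], y, w] = Cup3[c', y, w] := by
    intro y w
    rw [ht, hc', hβdef, ← hβG]
    congr 1
    rw [hqG, h5 w y, k3HilbertForm_comm 2 (φ w) (φ (g y))]
    ring
  rw [eq_of_cup3_eq hV hX hK hcup3]
  exact hc'alg

/-! ### §3 «KAPPA-IFF-SHARP»: HC⁴(X) ⟺ the `d − 1` kappa classes `κ_θ, …, κ_{θ^{d−1}}` are algebraic -/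

/-- **«KAPPA-IFF-SHARP» (Charles–Markman-free).** Marked smooth projective `K3^{[2]}`-type `(X, φ, P, z)`; `θ`
rational, type-preserving, `q`-self-adjoint, with the GEN clause of `RMgen[X, φ, z, d]` (every rational type-preserving
endomorphism is `Σ_{i<d} cᵢ θⁱ` on `T(X)`). Then **HC⁴(X) ⟺ `κ_{θᵏ} ∈ A²(X)` for `1 ≤ k < d`**. (⇒): each `κ_{θᵏ}` is a
rational `(2,2)`-class. (⇐): for every `k`, GEN gives `θᵏ = Σ_{i<d} cᵢ θⁱ` on `T(X)`, so `κ_{θᵏ} = κ_g + Σ cᵢ κ_{θⁱ}` with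
`g` as in «KAPPA-NS» (algebraic) and `κ_{θ⁰} = q^∨` algebraic (O'Grady); then KAPPA-IFF-ANY. Modulo
{Verbitsky–Guan, O'Grady 2008}; no Charles–Markman, no partner, no Markman, no Beauville.
[cite: Novario2026HodgeClassesHilbertSquares, Thm. 6.2 and §4] [cite: OGrady2008NumericalK3Square, §2.2 and §3]
[cite: Zarhin1983HodgeGroupsK3, Thm. 1.5.1] -/
theorem hodgeConjectureFor_iff_kappaClass_pow_lt_mem_algebraicClasses
    (hV : VerbitskyGuan_cohomology_K3HilbertSquareType) (hO : OGrady2008_dualBBFClass_algebraic)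
    (hX : IsSmoothProjective 4 X) (hK : IsOfK3HilbertSquareType X) (hM : MarkedK3Sq[X, φ, P, z])
    (θ : complexBetti X 2 →ₗ[ℂ] complexBetti X 2)
    (h1 : ∀ y, IsRationalClass y → IsRationalClass (θ y))
    (h2 : ∀ (i j : ℕ) y, IsOfHodgeType 4 X 2 i j y → IsOfHodgeType 4 X 2 i j (θ y))
    (h5 : ∀ y w : complexBetti X 2, k3HilbertForm 2 (φ (θ y)) (φ w) = k3HilbertForm 2 (φ y) (φ (θ w))) {d : ℕ}
    (hG : ∀ f : complexBetti X 2 →ₗ[ℂ] complexBetti X 2, (∀ y, IsRationalClass y → IsRationalClass (f y)) →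
      (∀ (i j : ℕ) y, IsOfHodgeType 4 X 2 i j y → IsOfHodgeType 4 X 2 i j (f y)) →
      ∃ c : Fin d → ℚ, ∀ y : complexBetti X 2,
        (∀ a : complexBetti X 2, a ∈ algebraicClasses X 1 → k3HilbertForm 2 (φ y) (φ a) = 0) →
          f y = ∑ i : Fin d, ((c i : ℂ) • (θ ^ (i : ℕ)) y)) :
    HodgeConjectureFor 4 X ↔ ∀ k : ℕ, 1 ≤ k → k < d → Kap[φ, θ ^ k] ∈ algebraicClasses X 2 := by
  classical
  have hiff := hodgeConjectureFor_iff_forall_kappaClass_pow_mem_algebraicClasses hV hO hX hK hM θ h1 h2 h5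
    (fun f hf1 hf2 _ _ => ⟨d, hG f hf1 hf2⟩)
  refine ⟨fun h k _ _ => (hiff.1 h) k, fun hκ => hiff.2 ?_⟩
  obtain ⟨L, hL⟩ := exists_kappaLinear (X := X) φ
  obtain ⟨A⟩ := (nonempty_hodgeModel_holds (n := 4) (X := X)).nonempty hX
  have hPrat := isRationalClass_pow_apply θ h1
  have hPtyp := isOfHodgeType_pow_apply θ h2
  have hPadj := k3HilbertForm_pow_selfAdjoint φ θ h5
  -- the `κ_{θⁱ}`, `i < d`, are algebraic (`i = 0`: O'Grady; `1 ≤ i`: hypothesis)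
  have hlow : ∀ i : Fin d, Kap[φ, θ ^ (i : ℕ)] ∈ algebraicClasses X 2 := by
    intro i
    by_cases hi : (i : ℕ) = 0
    · rw [hi, pow_zero]
      exact kappaClass_one_mem_algebraicClasses hO hX hK hM
    · exact hκ i (Nat.one_le_iff_ne_zero.2 hi) i.2
  intro k
  -- GEN: `θᵏ = Σ_{i<d} cᵢ θⁱ` on `T(X)`
  obtain ⟨c, hc⟩ := hG (θ ^ k) (hPrat k) (hPtyp k)
  set g : complexBetti X 2 →ₗ[ℂ] complexBetti X 2 :=
    θ ^ k + ∑ i : Fin d, ((-c i : ℚ) : ℂ) • θ ^ (i : ℕ) with hgdef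
  have hgapp : ∀ y, g y = (θ ^ k) y + ∑ i : Fin d, ((-c i : ℚ) : ℂ) • (θ ^ (i : ℕ)) y := fun y => by
    simp only [hgdef, LinearMap.add_apply, LinearMap.coe_sum, Finset.sum_apply, LinearMap.smul_apply]
  have hg1 : ∀ y, IsRationalClass y → IsRationalClass (g y) := fun y hy => by
    rw [hgapp]
    exact (hPrat k y hy).add (IsRationalClass.sum_smul _ (fun j => hPrat _ y hy) _)
  have hg11 : ∀ y, IsOfHodgeType 4 X 2 1 1 y → IsOfHodgeType 4 X 2 1 1 (g y) := fun y hy => by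
    rw [hgapp]
    exact (hPtyp k 1 1 y hy).add hX
      (IsOfHodgeType.sum hX A _ _ fun i _ => (hPtyp _ 1 1 y hy).smul _)
  have hg5 : ∀ y w : complexBetti X 2, k3HilbertForm 2 (φ (g y)) (φ w) = k3HilbertForm 2 (φ y) (φ (g w)) := by
    intro y w
    rw [hgapp, hgapp, map_add, map_add, k3HilbertForm_add_left, k3HilbertForm_add_right, hPadj,
      k3HilbertForm_sum_smul_left, k3HilbertForm_comm 2 (φ y) (φ (∑ i : Fin d, _)), k3HilbertForm_sum_smul_left]
    congr 1
    refine Finset.sum_congr rfl fun i _ => ?_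
    rw [hPadj, k3HilbertForm_comm]
  have hgT : ∀ y : complexBetti X 2, (∀ d ∈ algebraicClasses X 1, k3HilbertForm 2 (φ y) (φ d) = 0) → g y = 0 := by
    intro y hy
    rw [hgapp, hc y hy, ← Finset.sum_add_distrib]
    refine Finset.sum_eq_zero fun i _ => ?_
    rw [Rat.cast_neg, neg_smul, add_neg_cancel]
  have hκg := kappaClass_mem_algebraicClasses_of_eq_zero_on_transcendental hV hO hX hK hM g hg1 hg11 hg5 hgT
  -- `κ_{θᵏ} = κ_g − Σ (−cᵢ) κ_{θⁱ}` by linearity of `κ`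
  have hlin : Kap[φ, θ ^ k] = Kap[φ, g] - ∑ i : Fin d, ((-c i : ℚ) : ℂ) • Kap[φ, θ ^ (i : ℕ)] := by
    rw [← hL, ← hL, eq_sub_iff_add_eq, hgdef, map_add, map_sum]
    congr 1
    refine Finset.sum_congr rfl fun i _ => ?_
    rw [map_smul, hL]
  rw [hlin]
  exact Submodule.sub_mem _ hκg (Submodule.sum_mem _ fun i _ => Submodule.smul_mem _ _ (hlow i))

/-- **Pointwise (⇐) of «KAPPA-IFF-SHARP»**: a marked smooth projective `K3^{[2]}`-type fourfold with `RMgen[X, φ, z, d]`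
whose `d − 1` kappa classes `κ_θ, …, κ_{θ^{d−1}}` of the RM generator are algebraic satisfies HC⁴ — no partner, no
Markman, no Beauville, no Charles–Markman; modulo {Verbitsky–Guan, O'Grady 2008}. (The generator inside `RMgen` is
existentially bound, so the hypothesis is stated for every `θ` carrying the `RMgen` data, as in `CellKappa`.)
[cite: Novario2026HodgeClassesHilbertSquares, Thm. 6.2 and §4] [cite: OGrady2008NumericalK3Square, §3] -/
theorem hodgeConjectureFor_of_kappaClass_pow_lt_mem_algebraicClasses
    (hV : VerbitskyGuan_cohomology_K3HilbertSquareType) (hO : OGrady2008_dualBBFClass_algebraic)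
    (hX : IsSmoothProjective 4 X) (hK : IsOfK3HilbertSquareType X) (hM : MarkedK3Sq[X, φ, P, z])
    (θ : complexBetti X 2 →ₗ[ℂ] complexBetti X 2)
    (h1 : ∀ y, IsRationalClass y → IsRationalClass (θ y))
    (h2 : ∀ (i j : ℕ) y, IsOfHodgeType 4 X 2 i j y → IsOfHodgeType 4 X 2 i j (θ y))
    (h5 : ∀ y w : complexBetti X 2, k3HilbertForm 2 (φ (θ y)) (φ w) = k3HilbertForm 2 (φ y) (φ (θ w))) {d : ℕ}
    (hG : ∀ f : complexBetti X 2 →ₗ[ℂ] complexBetti X 2, (∀ y, IsRationalClass y → IsRationalClass (f y)) →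
      (∀ (i j : ℕ) y, IsOfHodgeType 4 X 2 i j y → IsOfHodgeType 4 X 2 i j (f y)) →
      ∃ c : Fin d → ℚ, ∀ y : complexBetti X 2,
        (∀ a : complexBetti X 2, a ∈ algebraicClasses X 1 → k3HilbertForm 2 (φ y) (φ a) = 0) →
          f y = ∑ i : Fin d, ((c i : ℂ) • (θ ^ (i : ℕ)) y))
    (hκ : ∀ k : ℕ, 1 ≤ k → k < d → Kap[φ, θ ^ k] ∈ algebraicClasses X 2) :
    HodgeConjectureFor 4 X :=
  (hodgeConjectureFor_iff_kappaClass_pow_lt_mem_algebraicClasses hV hO hX hK hM θ h1 h2 h5 hG).2 hκ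

/-! ### §4 The quadratic cells, and the orphan cell `(1,2)` BY NAME -/

/-- **`CellKappa[ρ, 2] → CellHC[ρ, 2]` WITHOUT Charles–Markman**: on a quadratic cell (`[E:ℚ] = 2`) the ONE class
`κ_θ` decides HC⁴ («KAPPA-IFF-SHARP» with `d = 2`: only `k = 1`). Modulo {Verbitsky–Guan, O'Grady 2008}.
[cite: Novario2026HodgeClassesHilbertSquares, Thm. 6.2 and §4] [cite: OGrady2008NumericalK3Square, §3] -/
theorem cellHC_of_cellKappa_of_two {ρ : ℕ} (hV : VerbitskyGuan_cohomology_K3HilbertSquareType)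
    (hO : OGrady2008_dualBBFClass_algebraic) (h : CellKappa[ρ, 2]) : CellHC[ρ, 2] := by
  intro X hX hK φ P z hM hsp hρ hgen
  obtain ⟨θ, h1, h2, h5, hdata⟩ := hgen
  obtain ⟨ev, hev, hevim, hdeg, hn, hG⟩ := id hdata
  refine hodgeConjectureFor_of_kappaClass_pow_lt_mem_algebraicClasses hV hO hX hK hM θ h1 h2 h5 hG fun k hk1 hk2 => ?_
  obtain rfl : k = 1 := by omega
  rw [pow_one]
  exact h X hX hK φ P z hM hsp hρ θ h1 h2 h5 hdata

/-- **`CellHC[ρ, 2] ↔ CellKappa[ρ, 2]`** modulo {Verbitsky–Guan, O'Grady 2008} only ((⇒) fact-free,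
`cellKappa_of_cellHC`). [cite: OGrady2008NumericalK3Square, §3] [cite: Markman2024, §1.1 Thm. 1.1] -/
theorem cellHC_iff_cellKappa_of_two {ρ : ℕ} (hV : VerbitskyGuan_cohomology_K3HilbertSquareType)
    (hO : OGrady2008_dualBBFClass_algebraic) : CellHC[ρ, 2] ↔ CellKappa[ρ, 2] :=
  ⟨cellKappa_of_cellHC, cellHC_of_cellKappa_of_two hV hO⟩

/-- **The ORPHAN cell `(1,2)`, BY NAME: `CellKappa[1, 2] → CellHC[1, 2]`** — every marked smooth projective
`K3^{[2]}`-type fourfold of Picard number `1` with real quadratic `E(X)` (hence NO projective K3 partner) whose ONE class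
`κ_θ` (`θ` the RM generator) is algebraic satisfies HC⁴. This is the honest residual of the cell: nothing in print or in
the tree constructs `κ_θ`. Modulo {Verbitsky–Guan, O'Grady 2008}; no Kuga–Satake, no Charles–Markman.
[cite: OGrady2008NumericalK3Square, §3] [cite: Zarhin1983HodgeGroupsK3, Thm. 1.5.1] [cite: Markman2024, §1.1 Thm. 1.1] -/
theorem orphanCellHC_12 (hV : VerbitskyGuan_cohomology_K3HilbertSquareType) (hO : OGrady2008_dualBBFClass_algebraic)
    (h : CellKappa[1, 2]) : CellHC[1, 2] :=
  cellHC_of_cellKappa_of_two hV hO h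

/-- **`CellHC[1, 2] ↔ CellKappa[1, 2]`**: HC⁴ on the orphan cell is EXACTLY the algebraicity of `κ_θ` on it. Modulo
{Verbitsky–Guan, O'Grady 2008}. [cite: OGrady2008NumericalK3Square, §3] [cite: Markman2024, §1.1 Thm. 1.1] -/
theorem cellHC_12_iff_cellKappa_12 (hV : VerbitskyGuan_cohomology_K3HilbertSquareType)
    (hO : OGrady2008_dualBBFClass_algebraic) : CellHC[1, 2] ↔ CellKappa[1, 2] :=
  cellHC_iff_cellKappa_of_two hV hO

end Summit.HodgeConjecture.HodgeConjecture.Theorems.MarkmanPartnerTransport.PartnerLattice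

end
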